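import Summits.ABC.ABC.Theses.CuspFieldPencil
import Summits.ABC.ABC.Theorems.CuspFieldPencilGoldenFromNFPencil
import Summits.ABC.ABC.Theorems.YuMatveevShapeRatCloses
import Literature.NumberTheory.DiophantineGeometry.PastenSubexpPlaces
import Literature.NumberTheory.DiophantineGeometry.AbcTwoAdicValuationProofs
import Literature.Barriers.ABC.BakerMethodBoundsThreeRoutesProofs
import Literature.Barriers.ABC.BakerMethodBoundsStewartYuProofs
import HarnessLib

/-!
# Sketch (stub-ideation k=2, GEN 3 — FAMILY 2 RESHAPE) for `stub_conjugateCuspTriple`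
(crux stmt-ABC-26026 `GoldenCuspShadow`, route CuspFieldPencil). Supersedes the gen-2 k2 sketch
`STUB_IDEAS_stub_conjugateCuspTriple_2_Sketch.lean` (namespace `SideaK2G2`), whose HEADLINE it keeps:
the CRUX follows unconditionally over `ℚ` from the kernel theorem
`Summit.ABC.ABC.Theorems.approximationBound_rat_holds : ∃ K ≥ 1, PastenApproximationBound K`.

GEN-3 RESHAPE (three moves):
* UNIFORMISE — the three quartic-specific `M`-sized helpers of gen 2 (H3u, H3w, H4) become TWO GENERIC
  signed-integer lemmas, literal siblings of tree theorems: the DIVISOR ROUTE `log|d| ≤ 3·Θ_{|a|,|b|}·Y·∑_{p∣d} p`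
  for `d ∣ a + b` (sibling of `Literature.Barriers.ABC.log_lt_route_c` / `Pasten.padic_bound_c`) and the
  ARCHIMEDEAN GAP `log|b| − log|a+b| < Θ_{|a|,|b|}·Y` (sibling of `Pasten.arch_bound`); the quartic enters only
  through `ring` identities, coprimality and two size bounds — and NO `(u,w) ↦ (w,−u)` symmetry is needed.
* CHANGE THE BOOTSTRAP VARIABLE — with `Y = log max(e, 2·(log 14 + 2·log H))` the self-improvement is the
  tree's PUBLIC `Literature.Barriers.ABC.le_of_le_mul_log_max` verbatim (gen-2's new lemma H7 disappears).
* QUANTIFIER ORDER — number theory and analysis are separated: `UWPre` (K-free pre-bound with `Y` explicit)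
  ⇒ `UWHalf` (generic real-variable endgame) ⇒ `GoldenCuspShadow` (exponent algebra).
Statements only (`sorry` bodies) except `ring`/one-line facts and the compositions.
-/

set_option linter.dupNamespace false
set_option linter.unusedVariables false

noncomputable section

open Finset Real Height UniqueFactorizationMonoid
open Literature.NumberTheory.DiophantineGeometry
open Literature.NumberTheory.DiophantineGeometry.Dioph
open Literature.NumberTheory.DiophantineGeometry.Pasten
open Literature.Barriers.ABC

namespace Summit.ABC.ABC.Cruxes.GoldenCuspShadow.SideaK2G3

/-! ### Targets -/

/-- The registered stub signature, verbatim (`Sig.stub_conjugateCuspTriple` of the birth skeleton). -/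
def StubConjugate : Prop :=
  ∀ ε : ℝ, 0 < ε → ∃ κ : ℝ, ∀ u w : ℤ, IsCoprime u w → u * w * (u ^ 2 - 11 * u * w - w ^ 2) ≠ 0 → Real.log (max (|(u : ℝ)|) (|(w : ℝ)|)) ≤ κ * (((UniqueFactorizationMonoid.radical (u * w * (u ^ 2 - 11 * u * w - w ^ 2))).natAbs : ℕ) : ℝ) ^ (ε : ℝ) * ((((UniqueFactorizationMonoid.radical (u ^ 2 - 11 * u * w - w ^ 2)).natAbs : ℕ) : ℝ) ^ (2 / 3 : ℝ) * (min (((UniqueFactorizationMonoid.radical u).natAbs : ℕ) : ℝ) (((UniqueFactorizationMonoid.radical w).natAbs : ℕ) : ℝ)) ^ (2 / 3 : ℝ))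

/-- `UWPre`: the PRE-BOUND (number theory done, analysis not yet): for every `δ > 0` there is `A ≥ 1` with
`log H ≤ A · R^δ · min(rad u, rad w) · log max(e, 2(log 14 + 2 log H))`, `H = max(|u|,|w|)`, `R = rad(uwQ)`. -/
def UWPre : Prop :=
  ∀ δ : ℝ, 0 < δ → ∃ A : ℝ, 1 ≤ A ∧ ∀ u w : ℤ, IsCoprime u w → u * w * (u ^ 2 - 11 * u * w - w ^ 2) ≠ 0 →
    Real.log (max (|(u : ℝ)|) (|(w : ℝ)|)) ≤
      A * (((radical (u * w * (u ^ 2 - 11 * u * w - w ^ 2))).natAbs : ℕ) : ℝ) ^ δ *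
        min (((radical u).natAbs : ℕ) : ℝ) (((radical w).natAbs : ℕ) : ℝ) *
        Real.log (max (Real.exp 1) (2 * (Real.log 14 + 2 * Real.log (max (|(u : ℝ)|) (|(w : ℝ)|)))))

/-- `UWHalf` (= gen-2 A1, verbatim): `log H ≤ κ_δ · R^δ · min(rad u, rad w)` for every `δ > 0`. -/
def UWHalf : Prop :=
  ∀ δ : ℝ, 0 < δ → ∃ κ : ℝ, ∀ u w : ℤ, IsCoprime u w → u * w * (u ^ 2 - 11 * u * w - w ^ 2) ≠ 0 →
    Real.log (max (|(u : ℝ)|) (|(w : ℝ)|)) ≤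
      κ * (((radical (u * w * (u ^ 2 - 11 * u * w - w ^ 2))).natAbs : ℕ) : ℝ) ^ δ *
        min (((radical u).natAbs : ℕ) : ℝ) (((radical w).natAbs : ℕ) : ℝ)

/-! ### L — GENERIC lemmas (signed integers; no quartic). Candidates for
`Summits/ABC/ABC/Theorems/CuspFieldPencilDivisorRoute.lean` (`--supports stmt-ABC-26026`). -/

/-- L1a (pointwise divisor route; sibling of `Pasten.padic_bound_c`, ~50 lines): `a, b` non-zero coprime
integers with `|a|·|b| > 1` and `a + b ≠ 0`; for every prime `p ∣ a + b`:
`ν_p(a+b)·log p < Θ_{|a|,|b|} · (p/log p) · (log p + log max{e, 2 log(|a|+|b|)})`.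
Proof: `Pasten.approx_div hK hP` at `u := a.natAbs, v := b.natAbs, N := 0, ζ := −sign a·sign b`
(`ζ·u/v = −a/b`, `1 − ζ·u/v = (a+b)/b`, `padicValRat p ((a+b)/b) = ν_p(|a+b|)` as `p ∤ b`),
then `logHeight₁_sign_mul_div_le`, `log_max_exp_mono`, `log_max_exp_mul_le` exactly as in `padic_bound_c`. -/
theorem factorization_mul_log_lt_of_dvd_add {K : ℝ} (hK : 1 ≤ K) (hP : PastenApproximationBound K)
    {a b : ℤ} (ha : a ≠ 0) (hb : b ≠ 0) (hab : IsCoprime a b) (h1 : 1 < a.natAbs * b.natAbs)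
    (hs : a + b ≠ 0) {p : ℕ} (hp : p.Prime) (hpd : (p : ℤ) ∣ a + b) :
    ((a + b).natAbs.factorization p : ℝ) * Real.log p <
      theta K a.natAbs b.natAbs 0 *
        ((p / Real.log p) * (Real.log p +
          Real.log (max (Real.exp 1) (2 * Real.log ((a.natAbs : ℝ) + b.natAbs))))) := by
  sorry

/-- L1 (summed DIVISOR ROUTE; sibling of `Literature.Barriers.ABC.log_lt_route_c`, ~40 lines from L1a):
for `d ∣ a + b`: `log|d| ≤ 3 · Θ_{|a|,|b|} · log max{e, 2 log(|a|+|b|)} · ∑_{p ∣ d} p`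
(`log_eq_sum_factorization_mul_log`, `Nat.factorization_le_iff_dvd` for `ν_p(|d|) ≤ ν_p(|a+b|)`,
`div_log_mul_add_le`, `Finset.sum_le_sum`; `d = ±1` gives `0 ≤ 0`). The junk cofactor `(a+b)/d` never appears. -/
theorem log_natAbs_le_of_dvd_add {K : ℝ} (hK : 1 ≤ K) (hP : PastenApproximationBound K)
    {a b d : ℤ} (ha : a ≠ 0) (hb : b ≠ 0) (hab : IsCoprime a b) (h1 : 1 < a.natAbs * b.natAbs)
    (hs : a + b ≠ 0) (hd : d ∣ a + b) :
    Real.log (d.natAbs : ℝ) ≤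
      3 * theta K a.natAbs b.natAbs 0 *
        Real.log (max (Real.exp 1) (2 * Real.log ((a.natAbs : ℝ) + b.natAbs))) *
        ∑ p ∈ d.natAbs.primeFactors, (p : ℝ) := by
  sorry

/-- L2 (ARCHIMEDEAN GAP; sibling of `Pasten.arch_bound`, ~40 lines): same hypotheses:
`log|b| − log|a + b| < Θ_{|a|,|b|} · log max{e, 2 log(|a|+|b|)}`
(`−log|1 − ζu/v| = −log|(a+b)/b| = log|b| − log|a+b|`; archimedean clause of `approx_div`). -/
theorem log_sub_log_lt_of_add {K : ℝ} (hK : 1 ≤ K) (hP : PastenApproximationBound K)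
    {a b : ℤ} (ha : a ≠ 0) (hb : b ≠ 0) (hab : IsCoprime a b) (h1 : 1 < a.natAbs * b.natAbs)
    (hs : a + b ≠ 0) :
    Real.log (b.natAbs : ℝ) - Real.log ((a + b).natAbs : ℝ) <
      theta K a.natAbs b.natAbs 0 *
        Real.log (max (Real.exp 1) (2 * Real.log ((a.natAbs : ℝ) + b.natAbs))) := by
  sorry

/-- L3 (absorption of Pasten's `Θ` at threshold `0`, ~30 lines; = gen-2 H5): `theta K a b 0 =
K^{ω(ab)+1}·∏_{p∣ab} log p ≤ C_δ·(∏_{p∣ab} p)^δ` uniformly (`theta_zero_eq`, `pow_succ`,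
`exists_pow_card_primeFactors_le_mul_rpow` and `exists_prod_log_primeFactors_le_mul_rpow` at `δ/2`, `Real.rpow_add`). -/
theorem exists_theta_zero_le_rpow {K : ℝ} (hK : 1 ≤ K) {δ : ℝ} (hδ : 0 < δ) :
    ∃ C : ℝ, 1 ≤ C ∧ ∀ a b : ℕ, a ≠ 0 → b ≠ 0 → a.Coprime b →
      theta K a b 0 ≤ C * (∏ p ∈ (a * b).primeFactors, (p : ℝ)) ^ δ := by
  sorry

/-- L4 (XS, induction on the finset, all primes `≥ 2`): `∑_{p∣n} p ≤ ∏_{p∣n} p = rad n`. -/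
theorem sum_primeFactors_le_radical (n : ℕ) :
    ∑ p ∈ n.primeFactors, (p : ℝ) ≤ ((radical n : ℕ) : ℝ) := by
  sorry

/-- L5 (GENERIC ENDGAME, pure real analysis, ~50 lines): if `X ≤ A·R^δ·m·log max(e, 2(log 14 + 2X))` with
`A, R, m ≥ 1`, `m ≤ R`, `X ≥ 0`, then `X ≤ c_δ·A²·R^{2δ}·m`.
Proof: `y := log 14 + 2X ≤ M·log max(e, 2y)` with `M := log 14 + 2AR^δm ≤ 5AR^δm`, so
`Literature.Barriers.ABC.le_of_le_mul_log_max : y ≤ 2M log(4M)`; `log(4M) ≤ log 20 + log A + δ log R + log m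
≤ (5 + 1/δ)·A·R^δ` by `Real.log_le_rpow_div` (`log R ≤ R^δ/δ`, `m ≤ R`, `log A ≤ A`); `X ≤ y/2`. -/
theorem endgame {δ : ℝ} (hδ : 0 < δ) :
    ∃ c : ℝ, 1 ≤ c ∧ ∀ A R m X : ℝ, 1 ≤ A → 1 ≤ R → 1 ≤ m → m ≤ R → 0 ≤ X →
      X ≤ A * R ^ δ * m * Real.log (max (Real.exp 1) (2 * (Real.log 14 + 2 * X))) →
      X ≤ c * A ^ 2 * R ^ (2 * δ) * m := by
  sorry

/-! ### Q — quartic-specific facts (`Q = u² − 11uw − w²`; XS–S each) -/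

/-- Q1u: the `u`-identity `Q + w² = u(u − 11w)` (so `u ∣ Q + w²`). -/
theorem quad_add_sq_w (u w : ℤ) : (u ^ 2 - 11 * u * w - w ^ 2) + w ^ 2 = u * (u - 11 * w) := by ring

/-- Q1w: the `w`-identity `−Q + u² = w(11u + w)` (so `w ∣ −Q + u²`). -/
theorem neg_quad_add_sq_u (u w : ℤ) : -(u ^ 2 - 11 * u * w - w ^ 2) + u ^ 2 = w * (11 * u + w) := by ring

/-- Q2: the pairs fed to L1/L2 are coprime (tree: `GoldenFromNFPencil.isCoprime_quadForm_right/left`,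
`IsCoprime.symm/.pow_right/.neg_left`). -/
theorem isCoprime_quad_sq {u w : ℤ} (h : IsCoprime u w) :
    IsCoprime (u ^ 2 - 11 * u * w - w ^ 2) (w ^ 2) ∧ IsCoprime (-(u ^ 2 - 11 * u * w - w ^ 2)) (u ^ 2) :=
  ⟨(Summit.ABC.ABC.Theorems.GoldenFromNFPencil.isCoprime_quadForm_right h).symm.pow_right,
   (Summit.ABC.ABC.Theorems.GoldenFromNFPencil.isCoprime_quadForm_left h).symm.pow_right.neg_left⟩

/-- Q3a (S): the DEGENERATE pairs — `u(u − 11w) = 0` or `w(11u + w) = 0` with `u, w` coprime, `uw ≠ 0` — are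
`±(11, 1)`, `±(1, −11)`; there `max(|u|,|w|) = 11` (and `Q = ∓1`), so any `A ≥ log 11` covers them. -/
theorem degenerate_max_eq {u w : ℤ} (h : IsCoprime u w) (hne : u * w * (u ^ 2 - 11 * u * w - w ^ 2) ≠ 0)
    (hdeg : u * (u - 11 * w) = 0 ∨ w * (11 * u + w) = 0) : max (|(u : ℝ)|) (|(w : ℝ)|) = 11 := by
  sorry

/-- Q3b (S): in the nondegenerate case the `1 < u·v` inputs of L1/L2 hold: `1 < |Q|·w²` and `1 < |Q|·u²`
(`|Q| = |w| = 1` forces `u(u ∓ 11) = 0`; `|Q| = |u| = 1` forces `w(w ± 11) = 0`). -/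
theorem one_lt_natAbs_quad_mul_sq {u w : ℤ} (h : IsCoprime u w)
    (hne : u * w * (u ^ 2 - 11 * u * w - w ^ 2) ≠ 0)
    (hu : u * (u - 11 * w) ≠ 0) (hw : w * (11 * u + w) ≠ 0) :
    1 < (u ^ 2 - 11 * u * w - w ^ 2).natAbs * (w ^ 2).natAbs ∧
      1 < (-(u ^ 2 - 11 * u * w - w ^ 2)).natAbs * (u ^ 2).natAbs := by
  sorry

/-- Q4a (XS): `|Q| + v² ≤ 14·H²` for `v ∈ {u, w}` (`|Q| ≤ |u|² + 11|u||w| + |w|² ≤ 13H²`), the input making both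
`Y`'s of L1/L2 at most `log max(e, 2(log 14 + 2 log H))` (`Real.log_le_log`, `Real.log_mul`, `Real.log_pow`). -/
theorem natAbs_quad_add_sq_le {u w : ℤ} {v : ℤ} (hv : v = u ∨ v = w) :
    (((u ^ 2 - 11 * u * w - w ^ 2).natAbs : ℝ) + (v ^ 2).natAbs) ≤
      14 * (max (|(u : ℝ)|) (|(w : ℝ)|)) ^ 2 := by
  sorry

/-- Q4b (XS): the junk cofactors are archimedeanly harmless: `|11u + w| ≤ 12|u|` if `|w| ≤ |u|`, and
`|u − 11w| ≤ 12|w|` if `|u| ≤ |w|` (`abs_add`, `abs_mul`). -/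
theorem junk_abs_le (u w : ℤ) :
    (|w| ≤ |u| → |11 * u + w| ≤ 12 * |u|) ∧ (|u| ≤ |w| → |u - 11 * w| ≤ 12 * |w|) := by
  sorry

/-- Q5 (S): prime-support bookkeeping against `R = rad(uwQ)`: for `v ∈ {u, w}`,
`∏_{p ∣ |Q|·v²} p ≤ R`, `1 ≤ rad v ≤ R` and `(rad v : ℝ) = ∏_{p∣|v|} p`
(`Nat.primeFactors_mul/_pow`, `Finset.prod_le_prod_of_subset_of_one_le'`, `Int.radical_eq_prod_primeFactors`,
`Int.radical_natAbs_eq_radical`, `GoldenFromNFPencil.natAbs_radical_prod`). -/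
theorem support_bookkeeping {u w : ℤ} (h : IsCoprime u w) (hne : u * w * (u ^ 2 - 11 * u * w - w ^ 2) ≠ 0)
    {v : ℤ} (hv : v = u ∨ v = w) :
    (∏ p ∈ ((u ^ 2 - 11 * u * w - w ^ 2).natAbs * (v ^ 2).natAbs).primeFactors, (p : ℝ)) ≤
        (((radical (u * w * (u ^ 2 - 11 * u * w - w ^ 2))).natAbs : ℕ) : ℝ) ∧
      1 ≤ (radical v).natAbs ∧
      (radical v).natAbs ≤ (radical (u * w * (u ^ 2 - 11 * u * w - w ^ 2))).natAbs ∧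
      (((radical v).natAbs : ℕ) : ℝ) = ∏ p ∈ v.natAbs.primeFactors, (p : ℝ) := by
  sorry

/-! ### A — assembly -/

/-- A1 (M, ~120 lines; THE prover target of the line): `UWPre`.
Recipe: `obtain ⟨K, hK, hP⟩ := Summit.ABC.ABC.Theorems.approximationBound_rat_holds`; fix `δ`; get `C` from L3;
put `A := max (Real.log 11) (3 + 4 * C)`. Given coprime `(u, w)` with `uwQ ≠ 0`, `H := max |u| |w| ≥ 1`:
* degenerate (`u(u−11w) = 0 ∨ w(11u+w) = 0`): Q3a, `log 11 ≤ A ≤ A·R^δ·m·Y` (all factors `≥ 1`);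
* else L1 twice — `(a,b,d) := (Q, w², u)` via Q1u and `(a,b,d) := (−Q, u², w)` via Q1w (coprime by Q2, `1 < |a||b|`
  by Q3b, `a + b ≠ 0` by nondegeneracy) — gives `log|u| ≤ 3Θ₁Y·∑_{p∣u}p`, `log|w| ≤ 3Θ₂Y·∑_{p∣w}p` with
  `Θ₁ = theta K |Q| (w²) 0`, `Θ₂ = theta K |Q| (u²) 0 ≤ C·R^δ` (L3 + Q5; note `(-Q).natAbs = Q.natAbs`) and both
  `Y`'s `≤ Y := log max(e, 2(log 14 + 2 log H))` (Q4a, `log_max_exp_mono`); `∑_{p∣v} p ≤ rad v` (L4 + Q5);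
* case `|w| ≤ |u|`: L2 at `(−Q, u²)`: `log(u²) − log|w(11u+w)| < Θ₂Y`, and `log|w(11u+w)| ≤ log|w| + log 12 + log|u|`
  (Q4b), so `log H < log 12 + Θ₂Y + log|w| ≤ (3 + 4C)·R^δ·Y·rad w`; together with `log H = log|u| ≤ 3C·R^δ·Y·rad u`
  this is `log H ≤ A·R^δ·min(rad u, rad w)·Y` (`le_min` is not needed: bound by each, hence by the min via `min_cases`);
* case `|u| ≤ |w|`: the same with L2 at `(Q, w²)` and the other half of Q4b. No symmetry substitution anywhere. -/
theorem uwPre_proof : UWPre := by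
  sorry

/-- A2 (S, ~30 lines): `UWPre → UWHalf` — apply `UWPre` at `δ/2`, then L5 `endgame` at `δ/2` with
`X := log H ≥ 0` (`|u| ≥ 1`), `R ≥ m ≥ 1` (Q5); `κ := c·A²`. -/
theorem uwHalf_of_uwPre (h : UWPre) : UWHalf := by
  sorry

/-- A3 (S, ~40 lines; = gen-2 A2): `UWHalf → GoldenCuspShadow` — `UWHalf` at `δ := ε`,
`min(rad u, rad w) ≤ ((rad u)(rad w))^{1/2} ≤ R^{1/2}` (`min_le_iff`, `Real.rpow_natCast`, `natAbs_radical_prod`,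
`rad Q ≥ 1`), `R^ε·R^{1/2} = R^{1/2+ε}` (`Real.rpow_add`), `κ' := max κ 0`. -/
theorem goldenCuspShadow_of_uwHalf (h : UWHalf) :
    Summit.ABC.ABC.Theses.CuspFieldPencil.GoldenCuspShadow := by
  sorry

/-- A4 (kernel-checked composition modulo the sorried pieces): the CRUX, unconditionally over `ℚ`. -/
theorem goldenCuspShadow_viaQ : Summit.ABC.ABC.Theses.CuspFieldPencil.GoldenCuspShadow :=
  goldenCuspShadow_of_uwHalf (uwHalf_of_uwPre uwPre_proof)

/-- A5 (S; what the ℚ-line gives of the stub AS TYPED): REGIME I `min(rad u, rad w) ≤ rad(Q)²·R^ε` —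
`UWHalf` at `δ := ε/2` and `R^{ε/2}·m ≤ R^ε·rad(Q)^{2/3}·m^{2/3} ⟸ m^{1/3} ≤ R^{ε/2}·rad(Q)^{2/3}`. REGIME II
(`rad Q` tiny: the unit/near-unit families `x₊ = φⁿγ`) is NOT reachable over `ℚ`; there the stub is the `k = 3`
conjugate sub-pencil of `NFPencilBound` (k1/k3 Plan 1), i.e. Scoones-conditional today. -/
theorem stub_regimeI_of_uwHalf (h : UWHalf) :
    ∀ ε : ℝ, 0 < ε → ∃ κ : ℝ, ∀ u w : ℤ, IsCoprime u w → u * w * (u ^ 2 - 11 * u * w - w ^ 2) ≠ 0 →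
      min (((radical u).natAbs : ℕ) : ℝ) (((radical w).natAbs : ℕ) : ℝ) ≤
          ((((radical (u ^ 2 - 11 * u * w - w ^ 2)).natAbs : ℕ) : ℝ)) ^ 2 *
            (((radical (u * w * (u ^ 2 - 11 * u * w - w ^ 2))).natAbs : ℕ) : ℝ) ^ ε →
      Real.log (max (|(u : ℝ)|) (|(w : ℝ)|)) ≤
        κ * (((radical (u * w * (u ^ 2 - 11 * u * w - w ^ 2))).natAbs : ℕ) : ℝ) ^ (ε : ℝ) *
          ((((radical (u ^ 2 - 11 * u * w - w ^ 2)).natAbs : ℕ) : ℝ) ^ (2 / 3 : ℝ) *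
            (min (((radical u).natAbs : ℕ) : ℝ) (((radical w).natAbs : ℕ) : ℝ)) ^ (2 / 3 : ℝ)) := by
  sorry

/-! ### RE-CUT PROPOSAL for the lead (place cut instead of cusp cut; `Sig`-pattern of the playbook).
Two genuine stubs, composition = modus ponens; neither stub is the crux (`UWPre` has `log log H` on the right and
no exponent `1/2`; the endgame is analysis + exponent algebra) nor the summit. -/

namespace Sig3

/-- S1: the number-theoretic pre-bound (A1; from L1, L2, L3, L4, Q1–Q5 and `approximationBound_rat_holds`). -/
def stub_uwPre : Prop := UWPre

/-- S2: the analytic endgame `UWPre → GoldenCuspShadow` (A2 ∘ A3; from L5 and the radical algebra). -/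
def stub_endgame : Prop := UWPre → Summit.ABC.ABC.Theses.CuspFieldPencil.GoldenCuspShadow

end Sig3

/-- The re-cut composition, BY NAME (what `Lines/<slug>.lean` would register as `GoldenCuspShadow_of`). -/
theorem GoldenCuspShadow_of_placeCut (h1 : Sig3.stub_uwPre) (h2 : Sig3.stub_endgame) :
    Summit.ABC.ABC.Theses.CuspFieldPencil.GoldenCuspShadow :=
  h2 h1

/-- Sanity: `StubConjugate` is literally the registered stub type. -/
example : StubConjugate =
    (∀ ε : ℝ, 0 < ε → ∃ κ : ℝ, ∀ u w : ℤ, IsCoprime u w → u * w * (u ^ 2 - 11 * u * w - w ^ 2) ≠ 0 → Real.log (max (|(u : ℝ)|) (|(w : ℝ)|)) ≤ κ * (((UniqueFactorizationMonoid.radical (u * w * (u ^ 2 - 11 * u * w - w ^ 2))).natAbs : ℕ) : ℝ) ^ (ε : ℝ) * ((((UniqueFactorizationMonoid.radical (u ^ 2 - 11 * u * w - w ^ 2)).natAbs : ℕ) : ℝ) ^ (2 / 3 : ℝ) * (min (((UniqueFactorizationMonoid.radical u).natAbs : ℕ) : ℝ) (((UniqueFactorizationMonoid.radical w).natAbs :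 ℕ) : ℝ)) ^ (2 / 3 : ℝ))) :=
  rfl

/-- Sanity: the kernel theorem the line rests on is in scope with its advertised type. -/
example : ∃ K : ℝ, 1 ≤ K ∧ PastenApproximationBound K :=
  Summit.ABC.ABC.Theorems.approximationBound_rat_holds

/-! ### CONVERGENCE with the split-stub k2 gen-3 plan (`STUB_IDEAS_stub_splitCuspTriple_2_g3.lean`,
namespace `SplitK2G3`): its reshape target `CuspMinRadBound` (copied verbatim below) IS `UWHalf` — `Iff.rfl`.
One landing of `UWHalf` therefore serves both k2 plans, closes the crux (A3/A4) and the split stub (their R1). -/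

/-- Verbatim copy of `SplitK2G3.CuspMinRadBound`. -/
def CuspMinRadBound : Prop :=
  ∀ ε : ℝ, 0 < ε → ∃ κ : ℝ, ∀ u w : ℤ, IsCoprime u w → u * w * (u ^ 2 - 11 * u * w - w ^ 2) ≠ 0 →
    Real.log (max (|(u : ℝ)|) (|(w : ℝ)|)) ≤
      κ * (((UniqueFactorizationMonoid.radical (u * w * (u ^ 2 - 11 * u * w - w ^ 2))).natAbs : ℕ) : ℝ) ^ (ε : ℝ) *
        min ((((UniqueFactorizationMonoid.radical u).natAbs : ℕ) : ℝ))
            ((((UniqueFactorizationMonoid.radical w).natAbs : ℕ) : ℝ))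

/-- The two gen-3 k2 reshape targets coincide syntactically. -/
theorem uwHalf_iff_cuspMinRadBound : UWHalf ↔ CuspMinRadBound := Iff.rfl

end Summit.ABC.ABC.Cruxes.GoldenCuspShadow.SideaK2G3

end
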